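import Mathlib
import HarnessLib
import Summits.HubbardSuperconductivity.HubbardSuperconductivity.Theorems.KLProgrammeC4aFoldSignedLaw
import Summits.HubbardSuperconductivity.HubbardSuperconductivity.Theorems.KLProgrammeC4aFoldLevelLayer

/-!
# Route `KLProgramme` — crux C4a, S3 brick (B4) «(U1)-LAWS» part 1: the TWO-SIDED FIRST-ORDER LAW OF A FOLD BOX — the φ-layer (signed fold law) composed with the
# e-layer (level layer) and put in the currency of the cover theorem: `∫de w(e)·|∫dv X(e,v)·∂_uK(e, g(e,v))| ≤ A₁·(1 + log⁺(Γ/|δ₀|))²·(1 + |δ₀|^{−1/2})`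

Cell `gate-hubbard-kl`, seat hubbard-kl-k3c3-p3 (g31; row «implicit-function / monotonicity route for μ(n)»).  Located brick for the (C)-closer lane / the (M4)
assembly of the umklapp first-order ϑ-layer (stub (C) `stub_twoLeg_curvature` of `KLRegimeEngineV17F2`, stmt-HubbardSuperconductivity-20437), memo
HOME/hubbard-kl-k3c3-p3/U1-CAUSTIC-SUP.md §9–§11.

WHY.  The cover theorem `…C4aCausticWindowCoverDispatch.intervalIntegral_caustic_nearCaustic_umklapp_le` (and every other ϑ-window call of the (U1) chain) takes the
first-order laws as HYPOTHESES keyed to the caustic offset `δ₀`: two-sided `F ≤ A₁·(1 + log⁺(Γ/|δ₀|))²·(1 + (√|δ₀|)⁻¹)` where `δ₀ ≠ 0`, plus the one-sided pre/post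
laws.  The laws themselves are the composition of two landed carrier-free layers — the loop-angle layer `…C4aFoldSignedLaw.abs_intervalIntegral_mul_deriv_comp_le_fold`
(`|∫dv X·K′(g)| ≤ (…)` across a fold, in terms of `M = max(t, |g(v*)|)`) and the level layer `…C4aFoldLevelLayer.intervalIntegral_fold_first_order_layer_le` (the
profile integral of `(1 + log⁺(G/e))·(A·M^{−3/2} + B·M^{−1})` under the fold-value drift `δ₀ − λ₂e ≤ m(e) ≤ δ₀ − λ₁e`) — followed by bookkeeping of logarithms.  This
file performs that composition ONCE, for an abstract FOLD-BOX FAMILY: levels `e ∈ [lo, hi]` (`lo > 0`), loop window `[α, β]`, bands `g e : ℝ → ℝ` (`C²`, fold point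
`v*(e) ∈ [α,β]` with `(g e)′(v*(e)) = 0`, floor `c₂ ≤ (g e)″`, ceiling `|(g e)″| ≤ L₂`, height `|g e| ≤ G` on the window, drift of the fold value `g e (v*(e))` against
`δ₀`), split kernel `K e : ℝ → ℝ` (`C¹`, envelopes `|K e u| ≤ 1/max(e,|u|)`, `|(K e)′ u| ≤ 1/max(e,|u|)²`), weight `X e : ℝ → ℝ` (`C¹`, `|X e| ≤ X₀`, `|(X e)′| ≤ X₁`,
vanishing at `α, β` — a partition-of-unity bump times the smooth first-order numerator), profile `0 ≤ w ≤ W`.  Nothing is specific to the Hubbard band: the actual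
partner band `ē(e,φ;ρ,ϑ,θ) = e_K(S − Φ(e,φ+θ))` delivers such a family on an adapted box under `FrameOK` (successor file `…C4aFoldBoxPartnerBand`), and the
(M4) assembly calls the present theorem per box.
* §1 **`fold_law_shape_le`** — the algebra: the right-hand side of the signed fold law at kernel floor `t = e` is
  `≤ (1 + ℓ)·(A·M⁻¹(√M)⁻¹ + B·M⁻¹)` with `A = X₀·(4/√L₂ + 16√L₂/c₂ + 64L₂²√L₂/c₂³)`, `B = 32X₁L₂/c₂²` (`ℓ` = the logarithm `log⁺(G/e)`).
* §2 **`intervalIntegral_foldBox_twoSided_le`** — THE COMPOSITION: `∫_{lo..hi} w(e)·|∫_{α..β} X(e,v)·(K e)′(g e v) dv| de ≤` the level layer's value with these `A, B`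
  (`O(|δ₀|^{−1/2}·log²)`, NO `lo`).
* §3 **`twoSided_value_le_lawShape`** (the level layer's value `≤ 3W·(C/λ₁)·(A√C + B)·(1 + log⁺(Γ/s))²·(1 + (√s)⁻¹)`, `C = 4 + 2λ₂ + λ₁`, for any ceiling
  `Γ ≥ λ₁·max(2G, hi)`) and the HEADLINE **`intervalIntegral_foldBox_twoSided_lawShape_le`**: the two-sided law of the fold box IN THE COVER THEOREM'S CURRENCY
  `A₁·((1 + log⁺(Γ/|δ₀|))²·(1 + (√|δ₀|)⁻¹))`, `A₁ = 3W·(C/λ₁)·(A√C + B)` — `n`-free (no `lo`), uniform in the box.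
Pure real analysis on landed lemmas; nothing about the model; nothing asserts (C), K3 or superconductivity.
References: Salmhofer 1999 §4.5.3 [cite: Salmhofer1999]; FST II CPAM 51 (1998) §3 [cite: FeldmanSalmhoferTrubowitz1998].
-/

noncomputable section

namespace Summit.HubbardSuperconductivity.HubbardSuperconductivity.Theorems.C4a

set_option linter.dupNamespace false -- summit = problem name (single-conjunct summit), D-0017

open Real Set MeasureTheory intervalIntegral

/-! ## §1 The shape of the signed fold law at kernel floor `t = e` -/

/-- **The algebra of the signed fold law.**  For `M, c₂, L₂ > 0`, `X₀, X₁, ℓ ≥ 0`, the right-hand side of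
`…C4aFoldSignedLaw.abs_intervalIntegral_mul_deriv_comp_le_fold` (with `η = √M/(2√L₂)`, `σ = c₂η`, logarithm `ℓ`) is at most
`(1 + ℓ)·(A·M⁻¹(√M)⁻¹ + B·M⁻¹)`, `A = X₀·(4/√L₂ + 16√L₂/c₂ + 64L₂²√L₂/c₂³)`, `B = 32X₁L₂/c₂²` — the input shape of the level layer. -/
theorem fold_law_shape_le {M c₂ L₂ X₀ X₁ ℓ : ℝ} (hM : 0 < M) (hc₂ : 0 < c₂) (hL₂ : 0 < L₂) (hX₀ : 0 ≤ X₀) (hX₁ : 0 ≤ X₁) (hℓ : 0 ≤ ℓ) :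
    8 * (Real.sqrt M / (2 * Real.sqrt L₂)) * X₀ / M ^ 2 +
        2 * (4 * X₀ / (M * (c₂ * (Real.sqrt M / (2 * Real.sqrt L₂)))) +
          (X₁ / (c₂ * (Real.sqrt M / (2 * Real.sqrt L₂))) + X₀ * L₂ / (c₂ * (Real.sqrt M / (2 * Real.sqrt L₂))) ^ 2) *
            ((c₂ * (Real.sqrt M / (2 * Real.sqrt L₂)))⁻¹ * (2 + 4 * ℓ))) ≤
      (1 + ℓ) * (X₀ * (4 / Real.sqrt L₂ + 16 * Real.sqrt L₂ / c₂ + 64 * L₂ ^ 2 * Real.sqrt L₂ / c₂ ^ 3) * (M⁻¹ * (Real.sqrt M)⁻¹) +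
        32 * X₁ * L₂ / c₂ ^ 2 * M⁻¹) := by
  obtain ⟨sM, hsM⟩ : ∃ sM : ℝ, sM = Real.sqrt M := ⟨_, rfl⟩
  obtain ⟨sL, hsL⟩ : ∃ sL : ℝ, sL = Real.sqrt L₂ := ⟨_, rfl⟩
  have hsMpos : 0 < sM := by rw [hsM]; exact Real.sqrt_pos.2 hM
  have hsLpos : 0 < sL := by rw [hsL]; exact Real.sqrt_pos.2 hL₂
  have hM2 : M = sM ^ 2 := by rw [hsM, Real.sq_sqrt hM.le]
  have hL2 : L₂ = sL ^ 2 := by rw [hsL, Real.sq_sqrt hL₂.le]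
  rw [← hsM, ← hsL]
  rw [hM2, hL2]
  -- the two pieces `E₁` (no logarithm) and `E₂` (times `2 + 4ℓ`)
  obtain ⟨E₁, hE₁⟩ : ∃ E₁ : ℝ, E₁ = (4 * X₀ / sL + 16 * X₀ * sL / c₂) * ((sM ^ 2)⁻¹ * sM⁻¹) := ⟨_, rfl⟩
  obtain ⟨E₂, hE₂⟩ : ∃ E₂ : ℝ, E₂ = 8 * X₁ * sL ^ 2 / c₂ ^ 2 * (sM ^ 2)⁻¹ + 16 * X₀ * (sL ^ 2) ^ 2 * sL / c₂ ^ 3 * ((sM ^ 2)⁻¹ * sM⁻¹) :=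
    ⟨_, rfl⟩
  have hE₁0 : 0 ≤ E₁ := by rw [hE₁]; positivity
  have hE₂0 : 0 ≤ E₂ := by rw [hE₂]; positivity
  have hkey : 8 * (sM / (2 * sL)) * X₀ / (sM ^ 2) ^ 2 +
        2 * (4 * X₀ / (sM ^ 2 * (c₂ * (sM / (2 * sL)))) +
          (X₁ / (c₂ * (sM / (2 * sL))) + X₀ * sL ^ 2 / (c₂ * (sM / (2 * sL))) ^ 2) * ((c₂ * (sM / (2 * sL)))⁻¹ * (2 + 4 * ℓ))) =
      E₁ + E₂ * (2 + 4 * ℓ) := by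
    rw [hE₁, hE₂]
    field_simp
    ring
  have hkey2 : (1 + ℓ) * (X₀ * (4 / sL + 16 * sL / c₂ + 64 * (sL ^ 2) ^ 2 * sL / c₂ ^ 3) * ((sM ^ 2)⁻¹ * sM⁻¹) +
        32 * X₁ * sL ^ 2 / c₂ ^ 2 * (sM ^ 2)⁻¹) = (1 + ℓ) * (E₁ + 4 * E₂) := by
    rw [hE₁, hE₂]
    field_simp
    ring
  rw [hkey, hkey2]
  nlinarith [mul_nonneg hℓ hE₁0, mul_nonneg hℓ hE₂0]

/-! ## §2 The composition: loop-angle layer ∘ level layer -/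

/-- **THE TWO-SIDED FIRST-ORDER LAW OF A FOLD BOX** (see the module docstring for the setting).  Levels `0 < lo ≤ hi`, loop window `[α, β]`; a fold-box family `g`
with fold points `v*`, floor `c₂`, curvature ceiling `L₂`, height `G`, and the drift `δ₀ − λ₂e ≤ g e (v* e) ≤ δ₀ − λ₁e` (`0 < λ₁ ≤ λ₂`, `δ₀ ≠ 0`); split kernel `K e`
with the envelopes at floor `e`; weight `X e` (`C¹`, `|X e| ≤ X₀`, `|(X e)′| ≤ X₁` on the window, `X e α = X e β = 0`); profile `0 ≤ w ≤ W`.  THEN the level integral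
of `w(e)·|∫_{α..β} X(e,v)·(K e)′(g e v) dv|` is at most the level layer's value with `A = X₀·(4/√L₂ + 16√L₂/c₂ + 64L₂²√L₂/c₂³)`, `B = 32X₁L₂/c₂²` — `O(|δ₀|^{−1/2}log²)`,
no `lo`.  (No integrability hypothesis in `e`.) -/
theorem intervalIntegral_foldBox_twoSided_le {g X K : ℝ → ℝ → ℝ} {vs w : ℝ → ℝ} {lo hi α β c₂ L₂ G X₀ X₁ W δ₀ la₁ la₂ : ℝ}
    (hlo : 0 < lo) (hlohi : lo ≤ hi) (hc₂ : 0 < c₂) (hG : 0 < G) (hX₀ : 0 ≤ X₀) (hX₁ : 0 ≤ X₁) (hW : 0 ≤ W)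
    (hla₁ : 0 < la₁) (hla₁₂ : la₁ ≤ la₂) (hδ₀ : 0 < |δ₀|)
    (hg : ∀ e ∈ Icc lo hi, ContDiff ℝ 2 (g e)) (hvs : ∀ e ∈ Icc lo hi, vs e ∈ Icc α β) (hcrit : ∀ e ∈ Icc lo hi, deriv (g e) (vs e) = 0)
    (hfloor : ∀ e ∈ Icc lo hi, ∀ v ∈ Icc α β, c₂ ≤ iteratedDeriv 2 (g e) v) (hL₂ : ∀ e ∈ Icc lo hi, ∀ v ∈ Icc α β, |iteratedDeriv 2 (g e) v| ≤ L₂)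
    (hgG : ∀ e ∈ Icc lo hi, ∀ v ∈ Icc α β, |g e v| ≤ G)
    (hdrift : ∀ e ∈ Icc lo hi, δ₀ - la₂ * e ≤ g e (vs e) ∧ g e (vs e) ≤ δ₀ - la₁ * e)
    (hK : ∀ e ∈ Icc lo hi, ContDiff ℝ 1 (K e)) (hK0 : ∀ e ∈ Icc lo hi, ∀ u, |K e u| ≤ (max e |u|)⁻¹)
    (hK1 : ∀ e ∈ Icc lo hi, ∀ u, |deriv (K e) u| ≤ (max e |u|)⁻¹ ^ 2)
    (hX : ∀ e ∈ Icc lo hi, ContDiff ℝ 1 (X e)) (hXb : ∀ e ∈ Icc lo hi, ∀ v ∈ Icc α β, |X e v| ≤ X₀)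
    (hX₁b : ∀ e ∈ Icc lo hi, ∀ v ∈ Icc α β, |deriv (X e) v| ≤ X₁) (hXα : ∀ e ∈ Icc lo hi, X e α = 0) (hXβ : ∀ e ∈ Icc lo hi, X e β = 0)
    (hw0 : ∀ e ∈ Icc lo hi, 0 ≤ w e) (hw : ∀ e ∈ Icc lo hi, w e ≤ W) :
    ∫ e in lo..hi, w e * |∫ v in α..β, X e v * deriv (K e) (g e v)| ≤
      W * (((1 + log⁺ (2 * G / (|δ₀| / la₁))) *
              (X₀ * (4 / Real.sqrt L₂ + 16 * Real.sqrt L₂ / c₂ + 64 * L₂ ^ 2 * Real.sqrt L₂ / c₂ ^ 3) * ((4 + 2 * la₂ + la₁) / |δ₀|) *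
                  (Real.sqrt (|δ₀| / (4 + 2 * la₂ + la₁)))⁻¹ +
                32 * X₁ * L₂ / c₂ ^ 2 * ((4 + 2 * la₂ + la₁) / |δ₀|)) +
            2 * (X₀ * (4 / Real.sqrt L₂ + 16 * Real.sqrt L₂ / c₂ + 64 * L₂ ^ 2 * Real.sqrt L₂ / c₂ ^ 3) * ((4 + 2 * la₂ + la₁) / |δ₀|) *
                  (Real.sqrt (|δ₀| / (4 + 2 * la₂ + la₁)))⁻¹ +
                32 * X₁ * L₂ / c₂ ^ 2 * ((4 + 2 * la₂ + la₁) / |δ₀|))) *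
          (|δ₀| / la₁) +
        (1 + log⁺ (G / (|δ₀| / la₁))) *
            (X₀ * (4 / Real.sqrt L₂ + 16 * Real.sqrt L₂ / c₂ + 64 * L₂ ^ 2 * Real.sqrt L₂ / c₂ ^ 3) * ((4 + 2 * la₂ + la₁) / la₁) *
                (Real.sqrt (|δ₀| / (4 + 2 * la₂ + la₁)))⁻¹ +
              32 * X₁ * L₂ / c₂ ^ 2 * ((4 + 2 * la₂ + la₁) / la₁)) *
          log⁺ (hi / (|δ₀| / la₁))) := by
  -- the curvature ceiling is positive
  have hloI : lo ∈ Icc lo hi := left_mem_Icc.2 hlohi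
  have hL₂pos : 0 < L₂ := by
    have h1 := hfloor lo hloI (vs lo) (hvs lo hloI)
    have h2 := hL₂ lo hloI (vs lo) (hvs lo hloI)
    exact hc₂.trans_le (h1.trans ((le_abs_self _).trans h2))
  have hA : 0 ≤ X₀ * (4 / Real.sqrt L₂ + 16 * Real.sqrt L₂ / c₂ + 64 * L₂ ^ 2 * Real.sqrt L₂ / c₂ ^ 3) := by positivity
  have hB : 0 ≤ 32 * X₁ * L₂ / c₂ ^ 2 := by positivity
  refine intervalIntegral_fold_first_order_layer_le (I := fun e => |∫ v in α..β, X e v * deriv (K e) (g e v)|) (m := fun e => g e (vs e))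
    hlo hlohi hW hA hB hG hla₁ hla₁₂ hδ₀ hdrift hw0 hw (fun e _ => abs_nonneg _) fun e he => ?_
  have he0 : 0 < e := hlo.trans_le he.1
  -- the loop-angle layer at kernel floor `t = e`
  have hφ := abs_intervalIntegral_mul_deriv_comp_le_fold (hvs e he) (hg e he) (hcrit e he) hc₂ (hfloor e he) (hL₂ e he) hG (hgG e he)
    (hK e he) he0 (hK0 e he) (hK1 e he) (hX e he) (hXb e he) (hX₁b e he) (hXα e he) (hXβ e he)
  have hM : 0 < max e |g e (vs e)| := lt_max_of_lt_left he0
  exact hφ.trans (fold_law_shape_le hM hc₂ hL₂pos hX₀ hX₁ Real.posLog_nonneg)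

/-! ## §3 The two-sided law in the cover theorem's currency -/
set_option maxHeartbeats 400000 in
/-- **The level layer's value in law shape.**  For `W, A, B, G, hi ≥ 0`, `s > 0`, `0 < λ₁ ≤ λ₂` and a ceiling `Γ` with `2Gλ₁ ≤ Γ`, `hi·λ₁ ≤ Γ`, the value of
`…C4aFoldLevelLayer.intervalIntegral_fold_first_order_layer_le` at `|δ₀| = s` is at most `3W·(C/λ₁)·(A√C + B)·((1 + log⁺(Γ/s))²·(1 + (√s)⁻¹))`, `C = 4 + 2λ₂ + λ₁`
(every logarithm is `≤ log⁺(Γ/s)`; `R·(s/λ₁) = (C/λ₁)(A√C(√s)⁻¹ + B)`; `3 + 2L + L² ≤ 3(1 + L)²`). -/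
theorem twoSided_value_le_lawShape {W A B G hi s la₁ la₂ Γ : ℝ} (hW : 0 ≤ W) (hA : 0 ≤ A) (hB : 0 ≤ B) (hG : 0 ≤ G) (hhi : 0 ≤ hi) (hs : 0 < s)
    (hla₁ : 0 < la₁) (hla₁₂ : la₁ ≤ la₂) (hΓ₁ : 2 * G * la₁ ≤ Γ) (hΓ₂ : hi * la₁ ≤ Γ) :
    W * (((1 + log⁺ (2 * G / (s / la₁))) * (A * ((4 + 2 * la₂ + la₁) / s) * (Real.sqrt (s / (4 + 2 * la₂ + la₁)))⁻¹ + B * ((4 + 2 * la₂ + la₁) / s)) +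
            2 * (A * ((4 + 2 * la₂ + la₁) / s) * (Real.sqrt (s / (4 + 2 * la₂ + la₁)))⁻¹ + B * ((4 + 2 * la₂ + la₁) / s))) *
          (s / la₁) +
        (1 + log⁺ (G / (s / la₁))) * (A * ((4 + 2 * la₂ + la₁) / la₁) * (Real.sqrt (s / (4 + 2 * la₂ + la₁)))⁻¹ + B * ((4 + 2 * la₂ + la₁) / la₁)) *
          log⁺ (hi / (s / la₁))) ≤
      3 * W * ((4 + 2 * la₂ + la₁) / la₁) * (A * Real.sqrt (4 + 2 * la₂ + la₁) + B) * ((1 + log⁺ (Γ / s)) ^ 2 * (1 + (Real.sqrt s)⁻¹)) := by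
  obtain ⟨C, hC⟩ : ∃ C : ℝ, C = 4 + 2 * la₂ + la₁ := ⟨_, rfl⟩
  have hCpos : 0 < C := by rw [hC]; linarith
  rw [← hC]
  obtain ⟨L, hL⟩ : ∃ L : ℝ, L = log⁺ (Γ / s) := ⟨_, rfl⟩
  have hL0 : 0 ≤ L := by rw [hL]; exact Real.posLog_nonneg
  have hposlog : ∀ y : ℝ, 0 ≤ log⁺ y := fun _ => Real.posLog_nonneg
  -- every logarithm is at most `L`
  have hΓ0 : 0 ≤ Γ := le_trans (by positivity) hΓ₁
  have h2G : log⁺ (2 * G / (s / la₁)) ≤ L := by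
    rw [hL]; refine Real.posLog_le_posLog (by positivity) ?_
    rw [div_div_eq_mul_div, div_le_div_iff_of_pos_right hs]; nlinarith
  have h1G : log⁺ (G / (s / la₁)) ≤ L := by
    rw [hL]; refine Real.posLog_le_posLog (by positivity) ?_
    rw [div_div_eq_mul_div, div_le_div_iff_of_pos_right hs]; nlinarith
  have hhiL : log⁺ (hi / (s / la₁)) ≤ L := by
    rw [hL]; refine Real.posLog_le_posLog (by positivity) ?_
    rw [div_div_eq_mul_div, div_le_div_iff_of_pos_right hs]; nlinarith
  -- `R·(s/λ₁) = Rλ`, `Rλ = (C/λ₁)(A√C(√s)⁻¹ + B)`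
  have hss : 0 < Real.sqrt s := Real.sqrt_pos.2 hs
  have hsC : 0 < Real.sqrt C := Real.sqrt_pos.2 hCpos
  have hsqrt : (Real.sqrt (s / C))⁻¹ = Real.sqrt C * (Real.sqrt s)⁻¹ := by
    rw [Real.sqrt_div' s hCpos.le, inv_div, div_eq_mul_inv]
  obtain ⟨Rl, hRl⟩ : ∃ Rl : ℝ, Rl = C / la₁ * (A * Real.sqrt C * (Real.sqrt s)⁻¹ + B) := ⟨_, rfl⟩
  have hRl0 : 0 ≤ Rl := by rw [hRl]; positivity
  have hR1 : (A * (C / s) * (Real.sqrt (s / C))⁻¹ + B * (C / s)) * (s / la₁) = Rl := by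
    rw [hsqrt, hRl]; field_simp
  have hR2 : A * (C / la₁) * (Real.sqrt (s / C))⁻¹ + B * (C / la₁) = Rl := by
    rw [hsqrt, hRl]; ring
  -- rewrite the value as `W·(Rλ·(3 + ℓ₁) + (1 + ℓ₂)·Rλ·ℓ₃)`
  have hval : W * (((1 + log⁺ (2 * G / (s / la₁))) * (A * (C / s) * (Real.sqrt (s / C))⁻¹ + B * (C / s)) +
            2 * (A * (C / s) * (Real.sqrt (s / C))⁻¹ + B * (C / s))) * (s / la₁) +
        (1 + log⁺ (G / (s / la₁))) * (A * (C / la₁) * (Real.sqrt (s / C))⁻¹ + B * (C / la₁)) * log⁺ (hi / (s / la₁))) =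
      W * (Rl * (3 + log⁺ (2 * G / (s / la₁))) + (1 + log⁺ (G / (s / la₁))) * Rl * log⁺ (hi / (s / la₁))) := by
    rw [hR2, ← hR1]; ring
  rw [hval]
  -- the bracket is `≤ 3(1 + L)²·Rλ`
  have hbr : Rl * (3 + log⁺ (2 * G / (s / la₁))) + (1 + log⁺ (G / (s / la₁))) * Rl * log⁺ (hi / (s / la₁)) ≤ Rl * (3 * (1 + L) ^ 2) := by
    have h1 : Rl * (3 + log⁺ (2 * G / (s / la₁))) ≤ Rl * (3 + L) := mul_le_mul_of_nonneg_left (by linarith) hRl0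
    have h2 : (1 + log⁺ (G / (s / la₁))) * Rl * log⁺ (hi / (s / la₁)) ≤ (1 + L) * Rl * L := by
      have ha : (1 + log⁺ (G / (s / la₁))) * Rl ≤ (1 + L) * Rl := mul_le_mul_of_nonneg_right (by linarith) hRl0
      have hb : 0 ≤ (1 + L) * Rl := by positivity
      calc (1 + log⁺ (G / (s / la₁))) * Rl * log⁺ (hi / (s / la₁)) ≤ (1 + L) * Rl * log⁺ (hi / (s / la₁)) :=
            mul_le_mul_of_nonneg_right ha (hposlog _)
        _ ≤ (1 + L) * Rl * L := mul_le_mul_of_nonneg_left hhiL hb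
    nlinarith [mul_nonneg hRl0 hL0, mul_nonneg hRl0 (mul_nonneg hL0 hL0)]
  -- `Rλ ≤ (C/λ₁)(A√C + B)(1 + (√s)⁻¹)`
  have hRl_le : Rl ≤ C / la₁ * (A * Real.sqrt C + B) * (1 + (Real.sqrt s)⁻¹) := by
    have hi0 : 0 ≤ (Real.sqrt s)⁻¹ := inv_nonneg.2 hss.le
    have hin : A * Real.sqrt C * (Real.sqrt s)⁻¹ + B ≤ (A * Real.sqrt C + B) * (1 + (Real.sqrt s)⁻¹) := by
      nlinarith [mul_nonneg hB hi0, mul_nonneg (mul_nonneg hA hsC.le) hi0, mul_nonneg hA hsC.le]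
    have hCl : 0 ≤ C / la₁ := by positivity
    rw [hRl]
    calc C / la₁ * (A * Real.sqrt C * (Real.sqrt s)⁻¹ + B) ≤ C / la₁ * ((A * Real.sqrt C + B) * (1 + (Real.sqrt s)⁻¹)) :=
          mul_le_mul_of_nonneg_left hin hCl
      _ = C / la₁ * (A * Real.sqrt C + B) * (1 + (Real.sqrt s)⁻¹) := by ring
  have hfin : W * (Rl * (3 * (1 + L) ^ 2)) ≤ 3 * W * (C / la₁) * (A * Real.sqrt C + B) * ((1 + L) ^ 2 * (1 + (Real.sqrt s)⁻¹)) := by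
    have h3 : 0 ≤ 3 * (1 + L) ^ 2 := by positivity
    have := mul_le_mul_of_nonneg_right hRl_le h3
    nlinarith [mul_le_mul_of_nonneg_left this hW]
  rw [← hL]
  exact (mul_le_mul_of_nonneg_left hbr hW).trans hfin

/-- **HEADLINE — THE TWO-SIDED LAW OF A FOLD BOX IN THE COVER THEOREM'S CURRENCY.**  Setting of `intervalIntegral_foldBox_twoSided_le`, plus a ceiling `Γ` with
`2Gλ₁ ≤ Γ` and `hi·λ₁ ≤ Γ`.  THEN
`∫_{lo..hi} w(e)·|∫_{α..β} X(e,v)·(K e)′(g e v) dv| de ≤ A₁·((1 + log⁺(Γ/|δ₀|))²·(1 + (√|δ₀|)⁻¹))`,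
`A₁ = 3W·(C/λ₁)·(A√C + B)`, `C = 4 + 2λ₂ + λ₁`, `A = X₀·(4/√L₂ + 16√L₂/c₂ + 64L₂²√L₂/c₂³)`, `B = 32X₁L₂/c₂²` — exactly the `hFlaw` hypothesis shape of
`…C4aCausticWindowCoverDispatch.intervalIntegral_caustic_nearCaustic_umklapp_le` / `…C4aCausticWindowDispatchTransversal.intervalIntegral_caustic_dispatch_transversal_le`,
with an `n`-free coefficient (no `lo`) that is uniform in the box. -/
theorem intervalIntegral_foldBox_twoSided_lawShape_le {g X K : ℝ → ℝ → ℝ} {vs w : ℝ → ℝ} {lo hi α β c₂ L₂ G X₀ X₁ W δ₀ la₁ la₂ Γ : ℝ}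
    (hlo : 0 < lo) (hlohi : lo ≤ hi) (hc₂ : 0 < c₂) (hG : 0 < G) (hX₀ : 0 ≤ X₀) (hX₁ : 0 ≤ X₁) (hW : 0 ≤ W)
    (hla₁ : 0 < la₁) (hla₁₂ : la₁ ≤ la₂) (hδ₀ : 0 < |δ₀|) (hΓ₁ : 2 * G * la₁ ≤ Γ) (hΓ₂ : hi * la₁ ≤ Γ)
    (hg : ∀ e ∈ Icc lo hi, ContDiff ℝ 2 (g e)) (hvs : ∀ e ∈ Icc lo hi, vs e ∈ Icc α β) (hcrit : ∀ e ∈ Icc lo hi, deriv (g e) (vs e) = 0)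
    (hfloor : ∀ e ∈ Icc lo hi, ∀ v ∈ Icc α β, c₂ ≤ iteratedDeriv 2 (g e) v) (hL₂ : ∀ e ∈ Icc lo hi, ∀ v ∈ Icc α β, |iteratedDeriv 2 (g e) v| ≤ L₂)
    (hgG : ∀ e ∈ Icc lo hi, ∀ v ∈ Icc α β, |g e v| ≤ G)
    (hdrift : ∀ e ∈ Icc lo hi, δ₀ - la₂ * e ≤ g e (vs e) ∧ g e (vs e) ≤ δ₀ - la₁ * e)
    (hK : ∀ e ∈ Icc lo hi, ContDiff ℝ 1 (K e)) (hK0 : ∀ e ∈ Icc lo hi, ∀ u, |K e u| ≤ (max e |u|)⁻¹)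
    (hK1 : ∀ e ∈ Icc lo hi, ∀ u, |deriv (K e) u| ≤ (max e |u|)⁻¹ ^ 2)
    (hX : ∀ e ∈ Icc lo hi, ContDiff ℝ 1 (X e)) (hXb : ∀ e ∈ Icc lo hi, ∀ v ∈ Icc α β, |X e v| ≤ X₀)
    (hX₁b : ∀ e ∈ Icc lo hi, ∀ v ∈ Icc α β, |deriv (X e) v| ≤ X₁) (hXα : ∀ e ∈ Icc lo hi, X e α = 0) (hXβ : ∀ e ∈ Icc lo hi, X e β = 0)
    (hw0 : ∀ e ∈ Icc lo hi, 0 ≤ w e) (hw : ∀ e ∈ Icc lo hi, w e ≤ W) :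
    ∫ e in lo..hi, w e * |∫ v in α..β, X e v * deriv (K e) (g e v)| ≤
      3 * W * ((4 + 2 * la₂ + la₁) / la₁) *
          (X₀ * (4 / Real.sqrt L₂ + 16 * Real.sqrt L₂ / c₂ + 64 * L₂ ^ 2 * Real.sqrt L₂ / c₂ ^ 3) * Real.sqrt (4 + 2 * la₂ + la₁) +
            32 * X₁ * L₂ / c₂ ^ 2) *
        ((1 + log⁺ (Γ / |δ₀|)) ^ 2 * (1 + (Real.sqrt |δ₀|)⁻¹)) := by
  have hloI : lo ∈ Icc lo hi := left_mem_Icc.2 hlohi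
  have hL₂pos : 0 < L₂ := by
    have h1 := hfloor lo hloI (vs lo) (hvs lo hloI)
    have h2 := hL₂ lo hloI (vs lo) (hvs lo hloI)
    exact hc₂.trans_le (h1.trans ((le_abs_self _).trans h2))
  have hA : 0 ≤ X₀ * (4 / Real.sqrt L₂ + 16 * Real.sqrt L₂ / c₂ + 64 * L₂ ^ 2 * Real.sqrt L₂ / c₂ ^ 3) := by positivity
  have hB : 0 ≤ 32 * X₁ * L₂ / c₂ ^ 2 := by positivity
  exact (intervalIntegral_foldBox_twoSided_le hlo hlohi hc₂ hG hX₀ hX₁ hW hla₁ hla₁₂ hδ₀ hg hvs hcrit hfloor hL₂ hgG hdrift hK hK0 hK1 hX hXb hX₁b hXα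
    hXβ hw0 hw).trans (twoSided_value_le_lawShape hW hA hB hG.le (hlo.le.trans hlohi) hδ₀ hla₁ hla₁₂ hΓ₁ hΓ₂)

/-! ## §4 The `|m|`-form: either side of the Fermi level -/

/-- **THE TWO-SIDED LAW OF A FOLD BOX, `|m|`-FORM (either side of the Fermi level).**  As `intervalIntegral_foldBox_twoSided_lawShape_le`, but the drift
`δ₀ − λ₂e ≤ m e ≤ δ₀ − λ₁e` is asked of an auxiliary profile `m` with `|m e| = |g e (v* e)|` only.  Above the Fermi surface take `m e = g e (v* e)`; BELOW it
(loop levels `−s`, `s ∈ [lo, hi]`) the fold value increases with the depth, and the law applies to the reflected family `s ↦ g (−s)` with `m s := −g (−s) (v*(−s))`,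
`δ₀ ↦ −δ₀` (`…C4aFoldBoxPartnerBand.partnerBand_foldValue_drift`, second clause) — the value depends on `δ₀` through `|δ₀|` only. -/
theorem intervalIntegral_foldBox_twoSided_lawShape_le_of_abs {g X K : ℝ → ℝ → ℝ} {vs w m : ℝ → ℝ} {lo hi α β c₂ L₂ G X₀ X₁ W δ₀ la₁ la₂ Γ : ℝ}
    (hlo : 0 < lo) (hlohi : lo ≤ hi) (hc₂ : 0 < c₂) (hG : 0 < G) (hX₀ : 0 ≤ X₀) (hX₁ : 0 ≤ X₁) (hW : 0 ≤ W)
    (hla₁ : 0 < la₁) (hla₁₂ : la₁ ≤ la₂) (hδ₀ : 0 < |δ₀|) (hΓ₁ : 2 * G * la₁ ≤ Γ) (hΓ₂ : hi * la₁ ≤ Γ)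
    (hg : ∀ e ∈ Icc lo hi, ContDiff ℝ 2 (g e)) (hvs : ∀ e ∈ Icc lo hi, vs e ∈ Icc α β) (hcrit : ∀ e ∈ Icc lo hi, deriv (g e) (vs e) = 0)
    (hfloor : ∀ e ∈ Icc lo hi, ∀ v ∈ Icc α β, c₂ ≤ iteratedDeriv 2 (g e) v) (hL₂ : ∀ e ∈ Icc lo hi, ∀ v ∈ Icc α β, |iteratedDeriv 2 (g e) v| ≤ L₂)
    (hgG : ∀ e ∈ Icc lo hi, ∀ v ∈ Icc α β, |g e v| ≤ G)
    (hm : ∀ e ∈ Icc lo hi, |m e| = |g e (vs e)|) (hdrift : ∀ e ∈ Icc lo hi, δ₀ - la₂ * e ≤ m e ∧ m e ≤ δ₀ - la₁ * e)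
    (hK : ∀ e ∈ Icc lo hi, ContDiff ℝ 1 (K e)) (hK0 : ∀ e ∈ Icc lo hi, ∀ u, |K e u| ≤ (max e |u|)⁻¹)
    (hK1 : ∀ e ∈ Icc lo hi, ∀ u, |deriv (K e) u| ≤ (max e |u|)⁻¹ ^ 2)
    (hX : ∀ e ∈ Icc lo hi, ContDiff ℝ 1 (X e)) (hXb : ∀ e ∈ Icc lo hi, ∀ v ∈ Icc α β, |X e v| ≤ X₀)
    (hX₁b : ∀ e ∈ Icc lo hi, ∀ v ∈ Icc α β, |deriv (X e) v| ≤ X₁) (hXα : ∀ e ∈ Icc lo hi, X e α = 0) (hXβ : ∀ e ∈ Icc lo hi, X e β = 0)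
    (hw0 : ∀ e ∈ Icc lo hi, 0 ≤ w e) (hw : ∀ e ∈ Icc lo hi, w e ≤ W) :
    ∫ e in lo..hi, w e * |∫ v in α..β, X e v * deriv (K e) (g e v)| ≤
      3 * W * ((4 + 2 * la₂ + la₁) / la₁) *
          (X₀ * (4 / Real.sqrt L₂ + 16 * Real.sqrt L₂ / c₂ + 64 * L₂ ^ 2 * Real.sqrt L₂ / c₂ ^ 3) * Real.sqrt (4 + 2 * la₂ + la₁) +
            32 * X₁ * L₂ / c₂ ^ 2) *
        ((1 + log⁺ (Γ / |δ₀|)) ^ 2 * (1 + (Real.sqrt |δ₀|)⁻¹)) := by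
  have hloI : lo ∈ Icc lo hi := left_mem_Icc.2 hlohi
  have hL₂pos : 0 < L₂ := by
    have h1 := hfloor lo hloI (vs lo) (hvs lo hloI)
    have h2 := hL₂ lo hloI (vs lo) (hvs lo hloI)
    exact hc₂.trans_le (h1.trans ((le_abs_self _).trans h2))
  have hA : 0 ≤ X₀ * (4 / Real.sqrt L₂ + 16 * Real.sqrt L₂ / c₂ + 64 * L₂ ^ 2 * Real.sqrt L₂ / c₂ ^ 3) := by positivity
  have hB : 0 ≤ 32 * X₁ * L₂ / c₂ ^ 2 := by positivity
  refine le_trans ?_ (twoSided_value_le_lawShape hW hA hB hG.le (hlo.le.trans hlohi) hδ₀ hla₁ hla₁₂ hΓ₁ hΓ₂)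
  refine intervalIntegral_fold_first_order_layer_le (I := fun e => |∫ v in α..β, X e v * deriv (K e) (g e v)|) (m := m)
    hlo hlohi hW hA hB hG hla₁ hla₁₂ hδ₀ hdrift hw0 hw (fun e _ => abs_nonneg _) fun e he => ?_
  have he0 : 0 < e := hlo.trans_le he.1
  have hφ := abs_intervalIntegral_mul_deriv_comp_le_fold (hvs e he) (hg e he) (hcrit e he) hc₂ (hfloor e he) (hL₂ e he) hG (hgG e he)
    (hK e he) he0 (hK0 e he) (hK1 e he) (hX e he) (hXb e he) (hX₁b e he) (hXα e he) (hXβ e he)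
  have hM : 0 < max e |g e (vs e)| := lt_max_of_lt_left he0
  rw [hm e he]
  exact hφ.trans (fold_law_shape_le hM hc₂ hL₂pos hX₀ hX₁ Real.posLog_nonneg)

end Summit.HubbardSuperconductivity.HubbardSuperconductivity.Theorems.C4a

end
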